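import Mathlib
import Summits.ResolutionOfSingularities.ResolutionOfSingularities.Theorems.RadicialJungCleanModelsPBasisMonomialIdeal
import Summits.ResolutionOfSingularities.ResolutionOfSingularities.Theorems.RadicialJungCleanModelsPBasisDualDerivations
import Literature.RingTheory.PBasis.KimuraNiitsuma1980Theorem31
import Literature.AlgebraicGeometry.Resolution.RegularLocalRingsProofs
import HarnessLib

/-!
# Route `RadicialJung`, crux `CleanModels` (stmt-15917) — lens 5, the `k = k̄` anchor of stub :249, part 1/5:
# LEMMA G preliminaries (derivations; regular systems of parameters: injectivity, reordering, exchange)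

Port (res-B-lead-1 g6) of §9 A–B of the crux workfile `Cruxes/DescentPerfectToAll/Lens5_KbarCossartAnchor.lean` rev 12 (author:
res-B-lens-5 g11; standalone copy `Lens5_KbarReadOff.lean` f4658622e3d840a0), statements and proofs verbatim, namespace renamed.
OURS · counted 0.  Nothing here proves resolution in characteristic `p`; resolution in char `p` is NOT proved.

Contents: `derivation_prod_pow_of_log` (logarithmic derivative of a monomial), `derivation_apply_mem_of_mem_sq` (`D(I²) ⊆ I`),
`rsop_injective` / `rsop_ne_zero` (a regular system of parameters of length `dim O` is injective with non-zero members),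
`prod_pow_extend`, `exists_reorder` (bring the indices with non-zero exponent to the front), `span_range_update_eq` (EXCHANGE:
replace `t_l` by `g ∈ 𝔪` when a dual derivation makes `D g` a unit).  Used by part 2 (`readOff_core`, LEMMA G = the read-off of
Cossart's `ν = 0` along a `p`-basis).
-/

noncomputable section

set_option linter.dupNamespace false

open IsLocalRing Literature.RingTheory.PBasis Literature.AlgebraicGeometry.Resolution
open Summit.ResolutionOfSingularities.ResolutionOfSingularities.Theorems.RadicialJung.CleanModels

namespace Summit.ResolutionOfSingularities.ResolutionOfSingularities.Theorems.RadicialJung.CleanModels.Lens5.KbarCossart.ReadOff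

/-! ### A. Generalities on derivations -/

section Deriv

variable {O : Type} [CommRing O]

omit [CommRing O] in
/-- `n · (x^{n-1} · (x w)) = n · x^n · w` (also for `n = 0`). [folklore] -/
theorem natCast_mul_pow_pred_mul [CommRing O] (n : ℕ) (x w : O) :
    (n : O) * (x ^ (n - 1) * (x * w)) = (n : O) * x ^ n * w := by
  rcases n with _ | k
  · simp
  · rw [Nat.add_sub_cancel, ← mul_assoc (x ^ k), ← pow_succ, mul_assoc]

/-- Logarithmic derivative of a product of powers: if `D xᵢ = xᵢ wᵢ` on `s` then
`D (∏_{i∈s} xᵢ^{bᵢ}) = (∏_{i∈s} xᵢ^{bᵢ}) · Σ_{i∈s} bᵢ wᵢ`. [folklore] -/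
theorem derivation_prod_pow_of_log {ι : Type*} (s : Finset ι) (D : Derivation ℤ O O) (x w : ι → O)
    (b : ι → ℕ) (h : ∀ i ∈ s, D (x i) = x i * w i) :
    D (∏ i ∈ s, x i ^ b i) = (∏ i ∈ s, x i ^ b i) * ∑ i ∈ s, (b i : O) * w i := by
  classical
  induction s using Finset.induction_on with
  | empty => simp
  | insert a s ha ih =>
    rw [Finset.prod_insert ha, Finset.sum_insert ha, D.leibniz,
      ih (fun j hj => h j (Finset.mem_insert_of_mem hj)), D.leibniz_pow,
      h a (Finset.mem_insert_self a s), smul_eq_mul, smul_eq_mul, smul_eq_mul, nsmul_eq_mul,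
      natCast_mul_pow_pred_mul]
    ring

/-- A derivation maps `I²` into `I`. [folklore] -/
theorem derivation_apply_mem_of_mem_sq (I : Ideal O) (D : Derivation ℤ O O) {v : O} (hv : v ∈ I ^ 2) :
    D v ∈ I := by
  rw [pow_two] at hv
  refine Submodule.mul_induction_on hv ?_ ?_
  · intro a ha c hc
    rw [D.leibniz, smul_eq_mul, smul_eq_mul]
    exact I.add_mem (I.mul_mem_right _ ha) (I.mul_mem_right _ hc)
  · intro x y hx hy
    rw [map_add]
    exact I.add_mem hx hy

/-- Evaluation of a finite sum of scaled derivations (indexed by an arbitrary finite type). [folklore] -/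
theorem sum_smul_derivation_apply' {ι : Type*} (s : Finset ι) (a : ι → O) (δ : ι → Derivation ℤ O O)
    (r : O) : (∑ i ∈ s, a i • δ i) r = ∑ i ∈ s, a i * δ i r := by
  rw [← Derivation.coeFnAddMonoidHom_apply, map_sum, Finset.sum_apply]
  refine Finset.sum_congr rfl fun i _ => ?_
  rw [Derivation.coeFnAddMonoidHom_apply, Derivation.smul_apply, smul_eq_mul]

end Deriv

/-! ### B. Regular systems of parameters: injectivity, reordering, exchange -/

section Rsop

variable {O : Type} [CommRing O]

/-- A family of `d = dim O` generators of the maximal ideal of a regular local ring is injective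
(a minimal system of generators). [cite: Matsumura1987, §14 p. 121] -/
theorem rsop_injective [IsRegularLocalRing O] {d : ℕ} (hd : ringKrullDim O = (d : WithBot ℕ∞))
    {t : Fin d → O} (ht : Ideal.span (Set.range t) = maximalIdeal O) : Function.Injective t := by
  classical
  intro i j hij
  by_contra hne
  have hsf : (maximalIdeal O).spanFinrank = d := by
    have h := IsRegularLocalRing.spanFinrank_maximalIdeal (R := O)
    rw [hd] at h
    exact_mod_cast h
  set S : Finset O := (Finset.univ.erase i).image t with hS
  have heq : Ideal.span (S : Set O) = maximalIdeal O := by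
    rw [← ht]
    apply le_antisymm
    · apply Ideal.span_mono
      intro x hx
      obtain ⟨l, -, rfl⟩ := Finset.mem_image.mp (Finset.mem_coe.mp hx)
      exact ⟨l, rfl⟩
    · rw [Ideal.span_le]
      rintro _ ⟨l, rfl⟩
      by_cases hl : l = i
      · subst hl
        rw [hij]
        exact Ideal.subset_span (Finset.mem_coe.mpr (Finset.mem_image.mpr
          ⟨j, Finset.mem_erase.mpr ⟨Ne.symm hne, Finset.mem_univ _⟩, rfl⟩))
      · exact Ideal.subset_span (Finset.mem_coe.mpr (Finset.mem_image.mpr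
          ⟨l, Finset.mem_erase.mpr ⟨hl, Finset.mem_univ _⟩, rfl⟩))
  have h1 : (maximalIdeal O).spanFinrank ≤ S.card := by
    rw [← heq, ← Set.ncard_coe_finset]
    exact Submodule.spanFinrank_span_le_ncard_of_finite S.finite_toSet
  have h2 : S.card ≤ d - 1 := by
    calc S.card ≤ (Finset.univ.erase i).card := Finset.card_image_le
      _ = d - 1 := by rw [Finset.card_erase_of_mem (Finset.mem_univ i), Finset.card_univ, Fintype.card_fin]
  have h3 : 0 < d := Fin.pos i
  omega

/-- No member of such a family vanishes. [cite: Matsumura1987, §14 p. 121] -/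
theorem rsop_ne_zero [IsRegularLocalRing O] {d : ℕ} (hd : ringKrullDim O = (d : WithBot ℕ∞))
    {t : Fin d → O} (ht : Ideal.span (Set.range t) = maximalIdeal O) (i : Fin d) : t i ≠ 0 := by
  intro h
  have := AbsolutePBasis.not_mem_sq_of_span_eq hd ht i
  rw [h] at this
  exact this (Ideal.zero_mem _)

/-- Extension by zero of an exponent vector on the first `e` indices. -/
theorem prod_pow_extend {d e : ℕ} (hed : e ≤ d) (τ : Fin d → O) (r : Fin e → ℕ) :
    ∏ l : Fin d, τ l ^ (if h : (l : ℕ) < e then r ⟨l, h⟩ else 0) =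
      ∏ i : Fin e, τ (Fin.castLE hed i) ^ r i := by
  classical
  have hinj : Function.Injective (Fin.castLE hed) := Fin.castLE_injective hed
  rw [← Finset.prod_subset (Finset.subset_univ (Finset.univ.image (Fin.castLE hed))),
    Finset.prod_image (fun i _ j _ h => hinj h)]
  · refine Finset.prod_congr rfl fun i _ => ?_
    rw [dif_pos (show ((Fin.castLE hed i : Fin d) : ℕ) < e from i.2)]
    rfl
  · intro l _ hl
    rw [dif_neg, pow_zero]
    intro h
    exact hl (Finset.mem_image.mpr ⟨⟨l, h⟩, Finset.mem_univ _, Fin.ext rfl⟩)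

/-- **Reordering.** Given `τ : Fin d → O` and exponents `ρ : Fin d → ℕ`, the family can be reordered so that
the indices with nonzero exponent come first: `∏ τ_l^{ρ_l} = ∏_{j<m} t'_j^{a'_j}` with `t'` a rearrangement of
`τ` (same range), `m = #{ρ ≠ 0}` and every `a'_j` a nonzero value of `ρ`. [folklore] -/
theorem exists_reorder {d : ℕ} (τ : Fin d → O) (ρ : Fin d → ℕ) :
    ∃ (m : ℕ) (hmd : m ≤ d) (t' : Fin d → O) (a' : Fin m → ℕ),
      Set.range t' = Set.range τ ∧ ((∃ l, ρ l ≠ 0) → 0 < m) ∧ (∀ j, ∃ l, ρ l ≠ 0 ∧ a' j = ρ l) ∧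
      ∏ l, τ l ^ ρ l = ∏ j : Fin m, t' (Fin.castLE hmd j) ^ a' j := by
  classical
  let S : Finset (Fin d) := Finset.univ.filter fun l => ρ l ≠ 0
  let T : Finset (Fin d) := Finset.univ.filter fun l => ¬ (ρ l ≠ 0)
  have hmn : S.card + T.card = d := by
    simp only [S, T]
    rw [Finset.card_filter_add_card_filter_not, Finset.card_univ, Fintype.card_fin]
  let σS : Fin S.card ↪o Fin d := S.orderEmbOfFin rfl
  let σT : Fin T.card ↪o Fin d := T.orderEmbOfFin rfl
  let u : Fin S.card → O := fun j => τ (σS j)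
  let v : Fin T.card → O := fun j => τ (σT j)
  let t' : Fin d → O := fun l => Fin.append u v (Fin.cast hmn.symm l)
  have hmd : S.card ≤ d := by omega
  have ht'cast : ∀ j : Fin S.card, t' (Fin.castLE hmd j) = τ (σS j) := by
    intro j
    show Fin.append u v (Fin.cast hmn.symm (Fin.castLE hmd j)) = τ (σS j)
    rw [show Fin.cast hmn.symm (Fin.castLE hmd j) = Fin.castAdd T.card j from Fin.ext rfl, Fin.append_left]
  refine ⟨S.card, hmd, t', fun j => ρ (σS j), ?_, ?_, ?_, ?_⟩
  · -- same range
    apply le_antisymm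
    · rintro _ ⟨l, rfl⟩
      show Fin.append u v (Fin.cast hmn.symm l) ∈ Set.range τ
      generalize Fin.cast hmn.symm l = i
      induction i using Fin.addCases with
      | left j => rw [Fin.append_left]; exact ⟨σS j, rfl⟩
      | right j => rw [Fin.append_right]; exact ⟨σT j, rfl⟩
    · rintro _ ⟨l, rfl⟩
      by_cases hl : ρ l ≠ 0
      · have hlS : l ∈ Set.range σS := by
          rw [Finset.range_orderEmbOfFin]; exact Finset.mem_coe.mpr (Finset.mem_filter.mpr ⟨Finset.mem_univ _, hl⟩)
        obtain ⟨j, hj⟩ := hlS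
        refine ⟨Fin.cast hmn (Fin.castAdd T.card j), ?_⟩
        show Fin.append u v (Fin.cast hmn.symm (Fin.cast hmn (Fin.castAdd T.card j))) = τ l
        rw [show Fin.cast hmn.symm (Fin.cast hmn (Fin.castAdd T.card j)) = Fin.castAdd T.card j from Fin.ext rfl,
          Fin.append_left, ← hj]
      · have hlT : l ∈ Set.range σT := by
          rw [Finset.range_orderEmbOfFin]; exact Finset.mem_coe.mpr (Finset.mem_filter.mpr ⟨Finset.mem_univ _, hl⟩)
        obtain ⟨j, hj⟩ := hlT
        refine ⟨Fin.cast hmn (Fin.natAdd S.card j), ?_⟩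
        show Fin.append u v (Fin.cast hmn.symm (Fin.cast hmn (Fin.natAdd S.card j))) = τ l
        rw [show Fin.cast hmn.symm (Fin.cast hmn (Fin.natAdd S.card j)) = Fin.natAdd S.card j from Fin.ext rfl,
          Fin.append_right, ← hj]
  · rintro ⟨l, hl⟩
    exact Finset.card_pos.mpr ⟨l, Finset.mem_filter.mpr ⟨Finset.mem_univ _, hl⟩⟩
  · intro j
    exact ⟨σS j, (Finset.mem_filter.mp (Finset.orderEmbOfFin_mem S rfl j)).2, rfl⟩
  · -- the product
    have h1 : ∏ j : Fin S.card, t' (Fin.castLE hmd j) ^ ρ (σS j) = ∏ l ∈ S, τ l ^ ρ l := by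
      rw [← Finset.prod_coe_sort S (fun l => τ l ^ ρ l)]
      refine Fintype.prod_equiv (S.orderIsoOfFin rfl).toEquiv _ _ fun j => ?_
      rw [ht'cast j]
      simp only [RelIso.coe_fn_toEquiv, Finset.coe_orderIsoOfFin_apply]
      rfl
    rw [h1]
    symm
    exact Finset.prod_filter_of_ne fun l _ hne h0 => hne (by rw [h0, pow_zero])

/-- **Exchange.** If `𝔪 = (t₁, …, t_d)`, `g ∈ 𝔪`, and a derivation `D` with `D t_l = 1`, `D t_{l'} = 0` (`l' ≠ l`)
has `D g` a unit, then replacing `t_l` by `g` still generates `𝔪`. [folklore] -/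
theorem span_range_update_eq [IsLocalRing O] {d : ℕ} (t : Fin d → O)
    (ht : Ideal.span (Set.range t) = maximalIdeal O) (l : Fin d) (g : O) (hg : g ∈ maximalIdeal O)
    (D : Derivation ℤ O O) (hDl : D (t l) = 1) (hD : ∀ l', l' ≠ l → D (t l') = 0) (hDg : IsUnit (D g)) :
    Ideal.span (Set.range (Function.update t l g)) = maximalIdeal O := by
  classical
  apply le_antisymm
  · rw [Ideal.span_le]
    rintro _ ⟨l', rfl⟩
    by_cases h : l' = l
    · subst h; rw [Function.update_self]; exact hg
    · rw [Function.update_of_ne h, SetLike.mem_coe, ← ht]; exact Ideal.subset_span ⟨l', rfl⟩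
  · conv_lhs => rw [← ht]
    rw [Ideal.span_le]
    rintro _ ⟨l', rfl⟩
    by_cases h : l' = l
    · subst h
      have hg' : g ∈ Ideal.span (Set.range t) := by rw [ht]; exact hg
      obtain ⟨a, ha⟩ := (Submodule.mem_span_range_iff_exists_fun O).mp hg'
      simp only [smul_eq_mul] at ha
      -- `D g = a l' + Σ t_i D(a_i)`
      have hDg' : D g = a l' + ∑ i, t i * D (a i) := by
        rw [← ha, map_sum]
        have : ∀ i, D (a i * t i) = a i * D (t i) + t i * D (a i) := fun i => by
          rw [D.leibniz, smul_eq_mul, smul_eq_mul]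
        simp_rw [this]
        rw [Finset.sum_add_distrib, Finset.sum_eq_single l' (fun i _ hi => by rw [hD i hi, mul_zero])
          (fun hn => (hn (Finset.mem_univ _)).elim), hDl, mul_one]
      have hal : IsUnit (a l') := by
        by_contra hnu
        have hmem : a l' ∈ maximalIdeal O := (IsLocalRing.mem_maximalIdeal _).mpr hnu
        have hsum : ∑ i, t i * D (a i) ∈ maximalIdeal O :=
          Ideal.sum_mem _ fun i _ => Ideal.mul_mem_right _ _ (by rw [← ht]; exact Ideal.subset_span ⟨i, rfl⟩)
        have : D g ∈ maximalIdeal O := by rw [hDg']; exact Ideal.add_mem _ hmem hsum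
        exact ((IsLocalRing.mem_maximalIdeal _).mp this) hDg
      obtain ⟨u, hu⟩ := hal
      have key : a l' * t l' = g - ∑ i ∈ Finset.univ.erase l', a i * t i := by
        rw [← ha, ← Finset.add_sum_erase _ _ (Finset.mem_univ l')]
        ring
      have htl : t l' = (↑u⁻¹ : O) * (g - ∑ i ∈ Finset.univ.erase l', a i * t i) := by
        rw [← key, ← hu, ← mul_assoc, Units.inv_mul, one_mul]
      rw [SetLike.mem_coe, htl]
      refine Ideal.mul_mem_left _ _ (Ideal.sub_mem _ ?_ (Ideal.sum_mem _ fun i hi => ?_))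
      · exact Ideal.subset_span ⟨l', Function.update_self ..⟩
      · refine Ideal.mul_mem_left _ _ (Ideal.subset_span ⟨i, ?_⟩)
        exact Function.update_of_ne (Finset.ne_of_mem_erase hi) g t
    · exact Ideal.subset_span ⟨l', Function.update_of_ne h g t⟩

end Rsop

end Summit.ResolutionOfSingularities.ResolutionOfSingularities.Theorems.RadicialJung.CleanModels.Lens5.KbarCossart.ReadOff

end
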